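import Summits.MatrixMultiplication.OmegaCensus.SmallFormats.InvertiblePointDeltaTable
import HarnessLib

/-!
# ω-census family (a): the δ-LAW, preparations — the free-column clause, block bookkeeping, no `L_ε` blocks

Cell `pub-omega` (unit `pub-omega-tensor`, gen 34), topic `Summits/MatrixMultiplication/OmegaCensus` (sub-folder
`SmallFormats`). Framing (verbatim): lottery ticket; floor = certified bounds/negative ranges. HONEST FRAMING: elementary
lemmas over an arbitrary field used by `InvertiblePointDeltaLaw` (the theorem `10n + 1 ≤ 3r` at a saturated invertible point
of an `r`-term computation of `⟨2,2,n⟩`):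
* `not_forall_vecMulVec_mem_ker` — the FREE-COLUMN CLAUSE at `X₀ = 1`: the common kernel of the vanishing terms' forms never
  contains a whole column `k² ⊗ ρ` (`ρ ≠ 0`); else an off form would be multiplicative (`f_one_mul_g_mul`,
  `not_mul_hom_matrix_two`, tensor g24).
* `cols_le_rows_of_ne_L`, `delta_add_le_of_ne_L`, `delta_add_le_of_ne_LT_one` — bookkeeping of the δ-table against rows and
  columns of the Weierstraß–Kronecker blocks (`KroneckerBlocks` conventions).
* `ne_L_of_footprints` — a block whose standard space receives block footprints spanning all of `k^{2×cols}` is not an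
  `L_ε` block (`L_topRight_eq_zero`).
* `two_mul_le_card_filter_ne` — at an invertible point at least `2n` X-forms do not vanish (the outputs of those terms span
  `k^{2×n}`, `top_le_span_w_off`).
Nothing here is a rank bound and nothing is a bound on `ω`.
-/

namespace Summit.MatrixMultiplication.OmegaCensus.SmallFormats

open Module Submodule Matrix Kronecker Kronecker.KBlock DeltaBlocks Literature.Computability.AlgebraicComplexity

namespace DeltaLaw

variable {k : Type*} [Field k] {n : ℕ} {ι : Type*} [Fintype ι] [DecidableEq ι]

/-- Row `r` of a `2 × n` matrix, as a linear map. -/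
def rowLM (n : ℕ) (r : Fin 2) : Matrix (Fin 2) (Fin n) k →ₗ[k] (Fin n → k) where
  toFun W := W r
  map_add' _ _ := rfl
  map_smul' _ _ := rfl

/-- `rowLM n r W = W r`. -/
@[simp] theorem rowLM_apply (r : Fin 2) (W : Matrix (Fin 2) (Fin n) k) : rowLM n r W = W r := rfl

/-- A vector is the sum of its coordinates times the unit vectors. -/
theorem eq_sum_smul_single (v : Fin n → k) : v = ∑ m, v m • Pi.single m (1 : k) := by
  conv_lhs => rw [← Finset.univ_sum_single v]
  refine Finset.sum_congr rfl fun m _ => ?_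
  rw [← Pi.single_smul, smul_eq_mul, mul_one]

/-- `X · (z ⊗ ρ) = (X z) ⊗ ρ`. -/
theorem mul_vecMulVec' (X : Matrix (Fin 2) (Fin 2) k) (z : Fin 2 → k) (ρ : Fin n → k) :
    X * vecMulVec z ρ = vecMulVec (X.mulVec z) ρ := by
  ext i j
  rw [Matrix.mul_apply, vecMulVec_apply, Matrix.mulVec, dotProduct, Finset.sum_mul]
  refine Finset.sum_congr rfl fun l _ => ?_
  rw [vecMulVec_apply, mul_assoc]

section Main

variable (β : BilinComp (mulBilin k 2 2 n) ι) (O : Finset ι)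

/-- **The free-column clause.** At a saturated `X₀ = 1`: the common kernel `K₀` of the forms `g_t`, `t ∉ O`, does not
contain a nonzero 'column' `k² ⊗ ρ` (all matrices `z ⊗ ρ`, `z ∈ k²`). Otherwise some off form `f_s` would be multiplicative
up to `f_s(1)` (`f_one_mul_g_mul`), contradicting `not_mul_hom_matrix_two`. -/
theorem not_forall_vecMulVec_mem_ker (hO : ∀ i, i ∉ O → β.f i 1 = 0) (hO' : ∀ i ∈ O, β.f i 1 ≠ 0)
    (hcard : O.card = 2 * n) {ρ : Fin n → k} (hρ : ρ ≠ 0)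
    (hK : ∀ z : Fin 2 → k, ∀ t, t ∉ O → β.g t (vecMulVec z ρ) = 0) : False := by
  classical
  set W₁ : Matrix (Fin 2) (Fin n) k := vecMulVec (Pi.single 0 1) ρ with hW₁
  have hW₁ne : W₁ ≠ 0 := by
    obtain ⟨j, hj⟩ := Function.ne_iff.mp hρ
    intro h
    have := congrFun (congrFun h 0) j
    rw [hW₁, vecMulVec_apply, Matrix.zero_apply] at this
    simp at this
    exact hj this
  -- some `s ∈ O` sees `W₁`
  have hex : ∃ s ∈ O, β.g s W₁ ≠ 0 := by
    by_contra hall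
    push Not at hall
    have h := mul_eq_sum_off β 1 O hO W₁
    rw [Matrix.one_mul] at h
    apply hW₁ne
    rw [h]
    exact Finset.sum_eq_zero fun s hs => by rw [hall s hs, mul_zero, zero_smul]
  obtain ⟨s, hs, hgs⟩ := hex
  have hg₁ : ∀ t, t ∉ O → β.g t W₁ = 0 := hK _
  have hgX : ∀ X : Matrix (Fin 2) (Fin 2) k, ∀ t, t ∉ O → β.g t (X * W₁) = 0 := fun X t ht => by
    rw [hW₁, mul_vecMulVec']; exact hK _ t ht
  refine not_mul_hom_matrix_two (β.f s) (hO' s hs) rfl fun A B => ?_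
  have h1 := f_one_mul_g_mul β O hO hcard hg₁ hs (A * B)
  have h2 := f_one_mul_g_mul β O hO hcard (hgX B) hs A
  have h3 := f_one_mul_g_mul β O hO hcard hg₁ hs B
  rw [Matrix.mul_assoc] at h1
  have key : β.f s (A * B) * β.f s 1 * β.g s W₁ = β.f s A * β.f s B * β.g s W₁ := by
    have e1 : β.f s 1 * (β.f s 1 * β.g s (A * (B * W₁))) = β.f s 1 * (β.f s (A * B) * β.g s W₁) := by rw [h1]
    have e2 : β.f s 1 * (β.f s 1 * β.g s (A * (B * W₁))) = β.f s A * (β.f s 1 * β.g s (B * W₁)) := by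
      rw [h2]; ring
    rw [h3] at e2
    linear_combination -e1 + e2
  exact mul_right_cancel₀ hgs key

end Main


/-! ## Block bookkeeping -/

omit [Field k] in
/-- A block that is not of type `L_ε` has at least as many rows as columns. -/
theorem cols_le_rows_of_ne_L (blk : KBlock k) (h : ∀ e, blk ≠ KBlock.L e) : blk.cols ≤ blk.rows := by
  match blk, h with
  | KBlock.L e, h => exact absurd rfl (h e)
  | KBlock.LT e, _ => simp [rows, cols]
  | KBlock.N u, _ => simp [rows, cols]
  | KBlock.C c, _ => simp [rows, cols]

omit [Field k] in
/-- `δ(blk) ≤ 2·(rows − cols)` for every non-`L` block. -/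
theorem delta_add_le_of_ne_L (blk : KBlock k) (h : ∀ e, blk ≠ KBlock.L e) : blk.delta + 2 * blk.cols ≤ 2 * blk.rows := by
  match blk, h with
  | KBlock.L e, h => exact absurd rfl (h e)
  | KBlock.LT 0, _ => simp [rows, cols, delta]
  | KBlock.LT 1, _ => simp [rows, cols, delta]
  | KBlock.LT 2, _ => simp [rows, cols, delta]
  | KBlock.LT (e + 3), _ => simp [rows, cols, delta]
  | KBlock.N u, _ => simp [rows, cols, delta]
  | KBlock.C c, _ => simp [rows, cols, delta]

omit [Field k] in
/-- `δ(blk) ≤ rows − cols` for every non-`L` block other than `L₁ᵀ`. -/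
theorem delta_add_le_of_ne_LT_one (blk : KBlock k) (h : ∀ e, blk ≠ KBlock.L e) (h1 : blk ≠ KBlock.LT 1) :
    blk.delta + blk.cols ≤ blk.rows := by
  match blk, h, h1 with
  | KBlock.L e, h, _ => exact absurd rfl (h e)
  | KBlock.LT 0, _, _ => simp [rows, cols, delta]
  | KBlock.LT 1, _, h1 => exact absurd rfl h1
  | KBlock.LT 2, _, _ => simp [rows, cols, delta]
  | KBlock.LT (e + 3), _, _ => simp [rows, cols, delta]
  | KBlock.N u, _, _ => simp [rows, cols, delta]
  | KBlock.C c, _, _ => simp [rows, cols, delta]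

/-- **No `L_ε` block under footprints spanning everything.** If a set `Φ` of `2 × cols` matrices spans the whole space and
every member of `Φ` is a block footprint for the standard space of `blk` (for some form `f` with `f(1) ≠ 0`), then `blk` is
not an `L_ε` block: all footprints have zero top-right entry (`L_topRight_eq_zero`) but `E_{0,ε}` does not. -/
theorem ne_L_of_footprints (blk : KBlock k) (Φ : Set (Matrix (Fin 2) (Fin blk.cols) k))
    (hΦ : ⊤ ≤ Submodule.span k Φ)
    (hfp : ∀ B ∈ Φ, ∃ f : Module.Dual k (Matrix (Fin 2) (Fin 2) k), f 1 ≠ 0 ∧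
      ∀ X : Matrix (Fin 2) (Fin 2) k, X * B - (f X * (f 1)⁻¹) • B ∈ blk.space) (e : ℕ) : blk ≠ KBlock.L e := by
  intro h
  subst h
  have hle : Submodule.span k Φ ≤ LinearMap.ker (entryLM (k := k) 0 (lastL (k := k) e)) := by
    refine Submodule.span_le.mpr fun B hB => ?_
    obtain ⟨f, hf, hfB⟩ := hfp B hB
    exact L_topRight_eq_zero (k := k) e hf hfB
  have h1 : (single 0 (lastL (k := k) e) (1 : k) : Matrix (Fin 2) (Fin (KBlock.L e : KBlock k).cols) k) ∈
      LinearMap.ker (entryLM (k := k) 0 (lastL (k := k) e)) := hle (hΦ Submodule.mem_top)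
  have : (single 0 (lastL (k := k) e) (1 : k) : Matrix (Fin 2) (Fin (KBlock.L e : KBlock k).cols) k) 0
      (lastL (k := k) e) = 0 := h1
  rw [single_apply_same] at this
  exact one_ne_zero this

section Count

open scoped Classical

omit [DecidableEq ι] in
/-- At an invertible point at least `2n` X-forms do not vanish (their outputs span `k^{2×n}`). -/
theorem two_mul_le_card_filter_ne (β : BilinComp (mulBilin k 2 2 n) ι) (X₀ : Matrix (Fin 2) (Fin 2) k)
    (hX₀ : IsUnit X₀.det) : 2 * n ≤ (Finset.univ.filter fun i => β.f i X₀ ≠ 0).card := by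
  classical
  set O := Finset.univ.filter fun i => β.f i X₀ ≠ 0 with hOdef
  have hO : ∀ i, i ∉ O → β.f i X₀ = 0 := fun i hi => by
    by_contra h; exact hi (Finset.mem_filter.mpr ⟨Finset.mem_univ i, h⟩)
  have h := top_le_span_w_off β X₀ hX₀ O hO
  have h1 : finrank k (Matrix (Fin 2) (Fin n) k) ≤ Fintype.card O := by
    rw [← finrank_top k (Matrix (Fin 2) (Fin n) k)]
    exact (Submodule.finrank_mono h).trans (finrank_range_le_card _)
  rw [finrank_matrix_fin, Fintype.card_coe] at h1
  exact h1

end Count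

end DeltaLaw

end Summit.MatrixMultiplication.OmegaCensus.SmallFormats
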